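import Mathlib
import Summits.ResolutionOfSingularities.ResolutionOfSingularities.Theorems.HomologicalConductorNoZenoStableAnnihilatorReduction
import Summits.ResolutionOfSingularities.ResolutionOfSingularities.Theorems.HomologicalConductorPersistenceSurfaceHullCover
import HarnessLib

/-!
# Rung S-2 `PersistenceSurface` (stmt-ResolutionOfSingularities-19970) — the SATURATION CRITERION behind `Sat₄`
# (`…PersistenceSurfaceLevelFour.SaturationFourSurface`, p503336): `caⁿ⁺² = caⁿ⁺¹` as soon as every `n`-th syzygy
# module is a retract of an `(n+1)`-th syzygy module (chain W4.4b, seat res-L1-w44b-stub-4 gen 3, memo SIGMA6b §1)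

[OURS · L1 w44b · Σ6] Nothing here is a statement of the manuscript under review (Hironaka 2017); AI-written,
weaker than expert review.

The typed level-four split of the surface rung (`persistenceSurface_of_saturationFour_of_levelFour`, res-type-011
p503336) asks at every stage `T` of the tower for the SATURATION `ca(T) ⊆ ca⁴(T)`.  By CA1
(`mem_cohomologyAnnihilatorOfDegree_succ_iff_forall_isSyzygy`, W4.4 p497920: `x ∈ caᵐ⁺¹(T)` iff `x` stably
annihilates every `m`-th syzygy module) this is a statement about SYZYGY MODULES ONLY:

* `cohomologyAnnihilatorOfDegree_le_of_forall_isSyzygy_retract` — if every `n`-th syzygy module `K = Ωⁿ M`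
  (`M` finitely generated) is a retract of some `(n+1)`-th syzygy module `K' = Ωⁿ⁺¹ M'`, then
  `caⁿ⁺²(T) ≤ caⁿ⁺¹(T)` (hence `=`, `cohomologyAnnihilatorOfDegree_succ_succ_eq_of_forall_isSyzygy_retract`).
* `cohomologyAnnihilatorOfDegree_add_eq_of_forall_isSyzygy_retract` — if the retract property holds at every
  level `m ≥ n`, then `caⁿ⁺¹⁺ᵏ(T) = caⁿ⁺¹(T)` for all `k`, and
* `cohomologyAnnihilator_eq_of_forall_isSyzygy_retract` — `ca(T) = caⁿ⁺¹(T)`: the SATURATION at level `n + 1`.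

READING (memo SIGMA6b §1).  Over a GORENSTEIN local ring of dimension `d` every maximal Cohen–Macaulay module is
stably a `j`-th syzygy for every `j` (cosyzygies exist), and `d`-th syzygies are MCM, so the hypothesis holds
for all `m ≥ d` and `ca(T) = caᵈ⁺¹(T)`; for `d = 2` this is `Sat₄` (indeed `Sat₃`).  Hence `Sat₄` is AUTOMATIC
at every Gorenstein stage of a surface tower (all hypersurface / complete-intersection stages: `E₁₂`,
`U_x(E₁₂)`, `Ẽ₈`, the elliptic quartic cone `U_x(Ẽ₈)`, `z^p + F`, every RDP), and has content only at
non-Gorenstein stages (e.g. the cyclic quotients `1/12(1,5)`, `1/3(1,1)` met in Σ6), where the chain's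
recurrence analysis (Rec) supplies the retract property.  The Gorenstein ⇒ cosyzygy step is not formalised
here (no MCM / canonical-module API); this file isolates the exact module-theoretic input.

Reference: Iyengar–Takahashi, IMRN 2016, arXiv:1404.1476, §2 [`IyengarTakahashi2014`].
-/

-- single-problem summit: the doubled namespace component `ResolutionOfSingularities` is forced
set_option linter.dupNamespace false

noncomputable section

open CategoryTheory Literature.RingTheory.CohomologyAnnihilator
open Summit.ResolutionOfSingularities.ResolutionOfSingularities.Theorems.NoZeno.SandwichCluster
open Summit.ResolutionOfSingularities.ResolutionOfSingularities.Theorems.HomologicalConductor.PersistenceSurfaceHullCover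

universe u

namespace Summit.ResolutionOfSingularities.ResolutionOfSingularities.Theorems.HomologicalConductor.PersistenceSaturationCriterion

variable {T : Type u} [CommRing T] [IsNoetherianRing T]

/-- **Saturation criterion, one step.** If every `n`-th syzygy module of a finitely generated `T`-module is a
retract of an `(n+1)`-th syzygy module of some finitely generated module, then `caⁿ⁺²(T) ≤ caⁿ⁺¹(T)`:
an element stably annihilating all `(n+1)`-th syzygies (CA1 at level `n+1`) stably annihilates their
retracts (HC-R), i.e. all `n`-th syzygies (CA1 at level `n`). [folklore] -/
theorem cohomologyAnnihilatorOfDegree_le_of_forall_isSyzygy_retract (n : ℕ)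
    (h : ∀ (M K : ModuleCat.{u} T), Module.Finite T M → IsSyzygy n M K →
      ∃ (M' K' : ModuleCat.{u} T) (i : K ⟶ K') (r : K' ⟶ K),
        Module.Finite T M' ∧ IsSyzygy (n + 1) M' K' ∧ i ≫ r = 𝟙 K) :
    cohomologyAnnihilatorOfDegree T (n + 2) ≤ cohomologyAnnihilatorOfDegree T (n + 1) := by
  intro x hx
  rw [mem_cohomologyAnnihilatorOfDegree_succ_iff_forall_isSyzygy]
  intro M K hM hK
  obtain ⟨M', K', i, r, hM', hK', hir⟩ := h M K hM hK
  exact StablyAnnihilates.of_retract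
    ((mem_cohomologyAnnihilatorOfDegree_succ_iff_forall_isSyzygy x).mp hx M' K' hM' hK') i r hir

/-- **Saturation criterion, one step, as an equality** `caⁿ⁺¹(T) = caⁿ⁺²(T)` (the tower is increasing).
[folklore] -/
theorem cohomologyAnnihilatorOfDegree_succ_succ_eq_of_forall_isSyzygy_retract (n : ℕ)
    (h : ∀ (M K : ModuleCat.{u} T), Module.Finite T M → IsSyzygy n M K →
      ∃ (M' K' : ModuleCat.{u} T) (i : K ⟶ K') (r : K' ⟶ K),
        Module.Finite T M' ∧ IsSyzygy (n + 1) M' K' ∧ i ≫ r = 𝟙 K) :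
    cohomologyAnnihilatorOfDegree T (n + 2) = cohomologyAnnihilatorOfDegree T (n + 1) :=
  le_antisymm (cohomologyAnnihilatorOfDegree_le_of_forall_isSyzygy_retract n h)
    (cohomologyAnnihilatorOfDegree_mono (Nat.le_succ _))

/-- **Saturation criterion, all higher levels.** If for every `m ≥ n` every `m`-th syzygy module is a retract
of an `(m+1)`-th syzygy module, then `caⁿ⁺¹⁺ᵏ(T) = caⁿ⁺¹(T)` for every `k`. [folklore] -/
theorem cohomologyAnnihilatorOfDegree_add_eq_of_forall_isSyzygy_retract (n : ℕ)
    (h : ∀ m : ℕ, n ≤ m → ∀ (M K : ModuleCat.{u} T), Module.Finite T M → IsSyzygy m M K →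
      ∃ (M' K' : ModuleCat.{u} T) (i : K ⟶ K') (r : K' ⟶ K),
        Module.Finite T M' ∧ IsSyzygy (m + 1) M' K' ∧ i ≫ r = 𝟙 K) (k : ℕ) :
    cohomologyAnnihilatorOfDegree T (n + 1 + k) = cohomologyAnnihilatorOfDegree T (n + 1) := by
  induction k with
  | zero => rfl
  | succ k ih =>
    rw [← ih, show n + 1 + (k + 1) = (n + k) + 2 by omega, show n + 1 + k = (n + k) + 1 by omega]
    exact cohomologyAnnihilatorOfDegree_succ_succ_eq_of_forall_isSyzygy_retract (n + k) (h (n + k) (by omega))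

/-- **Saturation of the cohomology annihilator** `ca(T) = caⁿ⁺¹(T)` under the retract property at all levels
`m ≥ n` (for a Gorenstein surface stage, `n = 2`: `ca = ca³ = ca⁴`, i.e. `Sat₄` of the S-2 split holds there).
[folklore] -/
theorem cohomologyAnnihilator_eq_of_forall_isSyzygy_retract (n : ℕ)
    (h : ∀ m : ℕ, n ≤ m → ∀ (M K : ModuleCat.{u} T), Module.Finite T M → IsSyzygy m M K →
      ∃ (M' K' : ModuleCat.{u} T) (i : K ⟶ K') (r : K' ⟶ K),
        Module.Finite T M' ∧ IsSyzygy (m + 1) M' K' ∧ i ≫ r = 𝟙 K) :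
    cohomologyAnnihilator T = cohomologyAnnihilatorOfDegree T (n + 1) := by
  apply le_antisymm
  · intro x hx
    obtain ⟨l, hl⟩ := mem_cohomologyAnnihilator_iff.mp hx
    by_cases hln : l ≤ n + 1
    · exact cohomologyAnnihilatorOfDegree_mono hln hl
    · obtain ⟨k, rfl⟩ : ∃ k, l = n + 1 + k := ⟨l - (n + 1), by omega⟩
      rwa [cohomologyAnnihilatorOfDegree_add_eq_of_forall_isSyzygy_retract n h k] at hl
  · exact cohomologyAnnihilatorOfDegree_le _

end Summit.ResolutionOfSingularities.ResolutionOfSingularities.Theorems.HomologicalConductor.PersistenceSaturationCriterion
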